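import Summits.QuantumFields.YangMills.Theorems.BalabanLadderNTClassicalShadowOrbitFloorWeightFree
import HarnessLib

/-!
# Crux `NT` (stmt-QuantumFields-19353), stub `stub_refpkgT : RefPkgT`: THE CLASSICAL SHADOW, XIX — the prices of the WEIGHT-FREE orbit floors, the
# kill-path feed, and the swap instance («a swap contrast on every ground state prices clause 2»)

Helper file (`--supports stmt-QuantumFields-19353`) of the fleet lead prover of crux `NT` (unit `ym-spine-19353-p1`, GEN 16); sequel of
`…ClassicalShadowOrbitFloorWeightFree` (this generation: `eventually_kerCov_le_of_orbitCov_le`, `eventually_kerCov_ge_of_orbitCov_ge`).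

* §1 **`orbitCovFloor_le_of_e2osc_neg`** — clause 2 of the registered package (depth `≥ 1`, unit `a → 0`, `ℓ > 0`, constant `C₂`) + a finite kernel-symmetric
  family + on EVERY ground state: orbit covariance `≤ −c₀`, orbit means within `ρ` of a common `t₀` ⇒ `c₀ − 2ρ² ≤ C₂ / min(d_x,d_y)⁴ / (1 + ‖y − x‖)⁴`;
  **`orbitCovFloor_le_of_e2osc_pos`** — orbit covariance `≥ c₀`, orbit-mean mismatch `≤ μ` ⇒ `c₀ − μ²/4 ≤ C₂ / min(d_x,d_y)⁴ / (1 + ‖y − x‖)⁴`;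
  **`zeroTempCovFloorUnbounded_of_orbitCovFloors_pos`** — such positive floors at unbounded separation ⇒ `ZeroTempCovFloorUnbounded G r` (⇒ `¬` clause 2
  at `(G, r)` for every unit, `not_e2osc_of_zeroTempCovFloorUnbounded`).
* §2 **`contrast_le_of_e2osc_swapContrast`** — the swap instance with every structural hypothesis discharged from the tree: a box and exterior invariant
  under the coordinate swap `i ↔ j`, a cube site `x`, and on EVERY ground state `U` a swap contrast `|dens_x(U) − dens_{x∘swap}(U)| ≥ Δ` with mean
  `(dens_x(U) + dens_{x∘swap}(U))/2` within `ρ` of a common value ⇒ **`Δ²/4 − 2ρ² ≤ C₂ / min(d_x, d_{x∘swap})⁴ / (1 + ‖x∘swap − x‖)⁴`**.  No one-orbit premise,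
  no reference configuration, no energy gap: the variational input is a property of each ground state separately (GEN 14's `contrast_le_of_e2osc_swapValley`
  is the case «contrast and mean CONSTANT on the ground states»).

HONEST FRAMING.  Consequences of the registered clause at fixed lattice geometry as `β → ∞`; the ground-state statistics are HYPOTHESES; nothing here
asserts that such boxes exist; no floor, not AF, not NT, not the seam, not the gap; not Clay.
-/

set_option autoImplicit false

noncomputable section

open MeasureTheory Filter Topology
open Literature.MathematicalPhysics.QuantumFieldTheory Literature.MathematicalPhysics.QuantumLattice
open Literature.Probability.LatticeModels
open Summit.QuantumFields.YangMills.Cruxes.OSLegsFromFemtoAndGap.DlrCollarTransfer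
open Summit.QuantumFields.YangMills.Cruxes.UVSeamRec.BoundaryLawPenetration

namespace Summit.QuantumFields.YangMills.Cruxes.NT.ClassicalShadow

variable {G : Type} [Group G] [TopologicalSpace G] [IsTopologicalGroup G] [CompactSpace G]
  [MeasurableSpace G] [BorelSpace G] (r : LatticeRep G)

/-! ## §1 The prices at `1 ≤ depth` and the kill-path feed -/

section Price

variable (a : ℝ → ℝ) {ι : Type} [Fintype ι] [Nonempty ι]

/-- **Clause 2 prices a box by the NEGATIVE orbit covariance carried by each of its ground states**: `c₀ − 2ρ² ≤ C₂ / min(d_x,d_y)⁴ / (1 + ‖y − x‖)⁴`.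
[folklore] -/
theorem orbitCovFloor_le_of_e2osc_neg (ha0 : Tendsto a atTop (𝓝 0)) {C₂ ℓ : ℝ} (hℓ : 0 < ℓ)
    (hE2 : ∃ β₂ : ℝ, ∀ β : ℝ, β₂ ≤ β → ∀ (c : Fin 4 → ℤ) (b : ℕ), (b : ℝ) * a β ≤ ℓ →
      ∀ (η η' : LGConfig 4 G) (x y : Fin 4 → ℤ), 1 ≤ depth c b x → 1 ≤ depth c b y →
        |kerCov G r β c b η (dens G r x) (dens G r y) - kerCov G r β c b η' (dens G r x) (dens G r y)| ≤
          C₂ / ((min (depth c b x) (depth c b y) : ℕ) : ℝ) ^ 4 / (1 + ‖siteToE (y - x)‖) ^ 4)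
    (c : Fin 4 → ℤ) (b : ℕ) (η : LGConfig 4 G) (γ : ι → LGConfig 4 G → LGConfig 4 G) (hγ : ∀ i, Continuous (γ i))
    (hsymm : ∀ (β : ℝ) (i : ι) (F : LGConfig 4 G → ℝ), Continuous F → kerE G r β c b η (F ∘ γ i) = kerE G r β c b η F)
    {x y : Fin 4 → ℤ} (hx : 1 ≤ depth c b x) (hy : 1 ≤ depth c b y) {c₀ ρ t₀ : ℝ}
    (hcov : ∀ ζ ∈ cubeMinimisers G r c b η,
      (∑ i, dens G r x (γ i (glueWith (cubeEdges c b) ζ η)) * dens G r y (γ i (glueWith (cubeEdges c b) ζ η))) / Fintype.card ι -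
        (∑ i, dens G r x (γ i (glueWith (cubeEdges c b) ζ η))) / Fintype.card ι *
          ((∑ i, dens G r y (γ i (glueWith (cubeEdges c b) ζ η))) / Fintype.card ι) ≤ -c₀)
    (hmx : ∀ ζ ∈ cubeMinimisers G r c b η, |(∑ i, dens G r x (γ i (glueWith (cubeEdges c b) ζ η))) / Fintype.card ι - t₀| ≤ ρ)
    (hmy : ∀ ζ ∈ cubeMinimisers G r c b η, |(∑ i, dens G r y (γ i (glueWith (cubeEdges c b) ζ η))) / Fintype.card ι - t₀| ≤ ρ) :
    c₀ - 2 * ρ ^ 2 ≤ C₂ / ((min (depth c b x) (depth c b y) : ℕ) : ℝ) ^ 4 / (1 + ‖siteToE (y - x)‖) ^ 4 := by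
  obtain ⟨β₂, H2⟩ := hE2
  refine le_of_forall_pos_le_add fun e he => ?_
  have he2 : 0 < e / 2 := half_pos he
  have h0 : ∀ᶠ β : ℝ in atTop, |kerCov G r β c b 1 (dens G r x) (dens G r y)| ≤ e / 2 := by
    have h := (tendsto_kerCov_one_dens_all r c b x y).abs
    rw [abs_zero] at h
    exact (h.eventually (eventually_le_nhds he2)).mono fun _ h => h
  have hneg := eventually_kerCov_le_of_orbitCov_le r c b η γ hγ hsymm hcov hmx hmy he2
  obtain ⟨β, hβ0, hβn, hb, hβ2⟩ := (h0.and (hneg.and ((eventually_mul_le_of_tendsto_zero ha0 hℓ b).and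
    (eventually_ge_atTop β₂)))).exists
  have hosc := H2 β hβ2 c b hb η 1 x y hx hy
  rw [abs_le] at hβ0 hosc
  linarith [hβ0.1, hβ0.2, hosc.1, hosc.2]

/-- **Clause 2 prices a box by the POSITIVE orbit covariance carried by each of its ground states**: `c₀ − μ²/4 ≤ C₂ / min(d_x,d_y)⁴ / (1 + ‖y − x‖)⁴`.
[folklore] -/
theorem orbitCovFloor_le_of_e2osc_pos (ha0 : Tendsto a atTop (𝓝 0)) {C₂ ℓ : ℝ} (hℓ : 0 < ℓ)
    (hE2 : ∃ β₂ : ℝ, ∀ β : ℝ, β₂ ≤ β → ∀ (c : Fin 4 → ℤ) (b : ℕ), (b : ℝ) * a β ≤ ℓ →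
      ∀ (η η' : LGConfig 4 G) (x y : Fin 4 → ℤ), 1 ≤ depth c b x → 1 ≤ depth c b y →
        |kerCov G r β c b η (dens G r x) (dens G r y) - kerCov G r β c b η' (dens G r x) (dens G r y)| ≤
          C₂ / ((min (depth c b x) (depth c b y) : ℕ) : ℝ) ^ 4 / (1 + ‖siteToE (y - x)‖) ^ 4)
    (c : Fin 4 → ℤ) (b : ℕ) (η : LGConfig 4 G) (γ : ι → LGConfig 4 G → LGConfig 4 G) (hγ : ∀ i, Continuous (γ i))
    (hsymm : ∀ (β : ℝ) (i : ι) (F : LGConfig 4 G → ℝ), Continuous F → kerE G r β c b η (F ∘ γ i) = kerE G r β c b η F)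
    {x y : Fin 4 → ℤ} (hx : 1 ≤ depth c b x) (hy : 1 ≤ depth c b y) {c₀ μ : ℝ}
    (hcov : ∀ ζ ∈ cubeMinimisers G r c b η,
      c₀ ≤ (∑ i, dens G r x (γ i (glueWith (cubeEdges c b) ζ η)) * dens G r y (γ i (glueWith (cubeEdges c b) ζ η))) / Fintype.card ι -
        (∑ i, dens G r x (γ i (glueWith (cubeEdges c b) ζ η))) / Fintype.card ι *
          ((∑ i, dens G r y (γ i (glueWith (cubeEdges c b) ζ η))) / Fintype.card ι))
    (hmm : ∀ ζ ∈ cubeMinimisers G r c b η,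
      |(∑ i, dens G r x (γ i (glueWith (cubeEdges c b) ζ η))) / Fintype.card ι -
        (∑ i, dens G r y (γ i (glueWith (cubeEdges c b) ζ η))) / Fintype.card ι| ≤ μ) :
    c₀ - μ ^ 2 / 4 ≤ C₂ / ((min (depth c b x) (depth c b y) : ℕ) : ℝ) ^ 4 / (1 + ‖siteToE (y - x)‖) ^ 4 := by
  obtain ⟨β₂, H2⟩ := hE2
  refine le_of_forall_pos_le_add fun e he => ?_
  have he2 : 0 < e / 2 := half_pos he
  have h0 : ∀ᶠ β : ℝ in atTop, |kerCov G r β c b 1 (dens G r x) (dens G r y)| ≤ e / 2 := by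
    have h := (tendsto_kerCov_one_dens_all r c b x y).abs
    rw [abs_zero] at h
    exact (h.eventually (eventually_le_nhds he2)).mono fun _ h => h
  have hpos := eventually_kerCov_ge_of_orbitCov_ge r c b η γ hγ hsymm hcov hmm he2
  obtain ⟨β, hβ0, hβp, hb, hβ2⟩ := (h0.and (hpos.and ((eventually_mul_le_of_tendsto_zero ha0 hℓ b).and
    (eventually_ge_atTop β₂)))).exists
  have hosc := H2 β hβ2 c b hb η 1 x y hx hy
  rw [abs_le] at hβ0 hosc
  linarith [hβ0.1, hβ0.2, hosc.1, hosc.2]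

/-- **Weight-free positive floors at unbounded separation ⇒ unbounded zero-temperature floor ⇒ `¬` clause 2 at `(G, r)`.**  For every `n`: a box, an
exterior, a finite kernel-symmetric family, two cube sites (depth `≥ 1`) at separation `≥ n`, and on EVERY ground state an orbit covariance `≥ c₁`
with orbit-mean mismatch `≤ μ`, where `c₁ − μ²/4 > c₀` for a fixed `c₀ > 0`.  Then `ZeroTempCovFloorUnbounded G r`.
[folklore] -/
theorem zeroTempCovFloorUnbounded_of_orbitCovFloors_pos {c₀ : ℝ} (hc₀ : 0 < c₀)
    (h : ∀ n : ℕ, ∃ (c : Fin 4 → ℤ) (b : ℕ) (η : LGConfig 4 G) (γ : ι → LGConfig 4 G → LGConfig 4 G) (x y : Fin 4 → ℤ) (c₁ μ : ℝ),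
      (∀ i, Continuous (γ i)) ∧
      (∀ (β : ℝ) (i : ι) (F : LGConfig 4 G → ℝ), Continuous F → kerE G r β c b η (F ∘ γ i) = kerE G r β c b η F) ∧
      1 ≤ depth c b x ∧ 1 ≤ depth c b y ∧ (n : ℝ) ≤ ‖siteToE (y - x)‖ ∧
      (∀ ζ ∈ cubeMinimisers G r c b η,
        c₁ ≤ (∑ i, dens G r x (γ i (glueWith (cubeEdges c b) ζ η)) * dens G r y (γ i (glueWith (cubeEdges c b) ζ η))) / Fintype.card ι -
          (∑ i, dens G r x (γ i (glueWith (cubeEdges c b) ζ η))) / Fintype.card ι *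
            ((∑ i, dens G r y (γ i (glueWith (cubeEdges c b) ζ η))) / Fintype.card ι)) ∧
      (∀ ζ ∈ cubeMinimisers G r c b η,
        |(∑ i, dens G r x (γ i (glueWith (cubeEdges c b) ζ η))) / Fintype.card ι -
          (∑ i, dens G r y (γ i (glueWith (cubeEdges c b) ζ η))) / Fintype.card ι| ≤ μ) ∧
      c₀ < c₁ - μ ^ 2 / 4) :
    ZeroTempCovFloorUnbounded G r := by
  refine zeroTempCovFloorUnbounded_of_nondecaying r hc₀ fun n => ?_
  obtain ⟨c, b, η, γ, x, y, c₁, μ, hγ, hsymm, hx, hy, hsep, hcov, hmm, hgap⟩ := h n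
  refine ⟨c, b, η, x, y, hx, hy, hsep, Filter.Eventually.frequently ?_⟩
  have hε : 0 < c₁ - μ ^ 2 / 4 - c₀ := by linarith
  filter_upwards [eventually_kerCov_ge_of_orbitCov_ge r c b η γ hγ hsymm hcov hmm hε] with β hβ
  have : c₀ ≤ kerCov G r β c b η (dens G r x) (dens G r y) := by linarith
  exact this.trans (le_abs_self _)

end Price

/-! ## §2 The swap instance: a contrast floor on every ground state prices clause 2, with nothing else assumed -/

section Swap

variable (a : ℝ → ℝ)

/-- **Clause 2 is priced by the swap contrast of EVERY ground state.**  Clause 2 of the registered package (depth `≥ 1`, unit `a → 0`, `ℓ > 0`,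
constant `C₂`), a box `(c, b)` and exterior `η` invariant under the coordinate swap `i ↔ j`, a cube site `x`, and on EVERY ground state `U`: swap contrast
`|dens_x(U) − dens_{x∘swap}(U)| ≥ Δ` and mean `(dens_x(U) + dens_{x∘swap}(U))/2` within `ρ` of a common value `t₀` ⇒
`Δ²/4 − 2ρ² ≤ C₂ / min(d_x, d_{x∘swap})⁴ / (1 + ‖x∘swap − x‖)⁴`.  No one-orbit premise, no reference configuration. [folklore] -/
theorem contrast_le_of_e2osc_swapContrast (ha0 : Tendsto a atTop (𝓝 0)) {C₂ ℓ : ℝ} (hℓ : 0 < ℓ)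
    (hE2 : ∃ β₂ : ℝ, ∀ β : ℝ, β₂ ≤ β → ∀ (c : Fin 4 → ℤ) (b : ℕ), (b : ℝ) * a β ≤ ℓ →
      ∀ (η η' : LGConfig 4 G) (x y : Fin 4 → ℤ), 1 ≤ depth c b x → 1 ≤ depth c b y →
        |kerCov G r β c b η (dens G r x) (dens G r y) - kerCov G r β c b η' (dens G r x) (dens G r y)| ≤
          C₂ / ((min (depth c b x) (depth c b y) : ℕ) : ℝ) ^ 4 / (1 + ‖siteToE (y - x)‖) ^ 4)
    (i j : Fin 4) {c : Fin 4 → ℤ} (hc : c ∘ Equiv.swap i j = c) (b : ℕ) {η : LGConfig 4 G}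
    (hη : relabelConfig (edgePerm (Equiv.swap i j)) η = η) {x : Fin 4 → ℤ}
    (hx : 1 ≤ depth c b x) (hy : 1 ≤ depth c b (x ∘ Equiv.swap i j)) {Δ ρ t₀ : ℝ} (hΔ : 0 ≤ Δ)
    (hGS : ∀ ζ ∈ cubeMinimisers G r c b η,
      Δ ≤ |dens G r x (glueWith (cubeEdges c b) ζ η) - dens G r (x ∘ Equiv.swap i j) (glueWith (cubeEdges c b) ζ η)| ∧
      |(dens G r x (glueWith (cubeEdges c b) ζ η) + dens G r (x ∘ Equiv.swap i j) (glueWith (cubeEdges c b) ζ η)) / 2 - t₀| ≤ ρ) :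
    Δ ^ 2 / 4 - 2 * ρ ^ 2 ≤
      C₂ / ((min (depth c b x) (depth c b (x ∘ Equiv.swap i j)) : ℕ) : ℝ) ^ 4 / (1 + ‖siteToE (x ∘ Equiv.swap i j - x)‖) ^ 4 := by
  have hxx := comp_swap_comp_swap i j x
  -- orbit statistics of the swap family on a configuration `U`: covariance −(p−q)²/4, both means (p+q)/2
  have hstat : ∀ U : LGConfig 4 G,
      (∑ s : Bool, dens G r x ((fun (s : Bool) (V : LGConfig 4 G) => cond s (relabelConfig (edgePerm (Equiv.swap i j)) V) V) s U) *
            dens G r (x ∘ Equiv.swap i j) ((fun (s : Bool) (V : LGConfig 4 G) => cond s (relabelConfig (edgePerm (Equiv.swap i j)) V) V) s U)) /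
          Fintype.card Bool -
        (∑ s : Bool, dens G r x ((fun (s : Bool) (V : LGConfig 4 G) => cond s (relabelConfig (edgePerm (Equiv.swap i j)) V) V) s U)) /
            Fintype.card Bool *
          ((∑ s : Bool, dens G r (x ∘ Equiv.swap i j)
              ((fun (s : Bool) (V : LGConfig 4 G) => cond s (relabelConfig (edgePerm (Equiv.swap i j)) V) V) s U)) / Fintype.card Bool) =
        -((dens G r x U - dens G r (x ∘ Equiv.swap i j) U) ^ 2 / 4) := fun U => swapFamily_orbitCov r i j U x
  have hmeanx : ∀ U : LGConfig 4 G,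
      (∑ s : Bool, dens G r x ((fun (s : Bool) (V : LGConfig 4 G) => cond s (relabelConfig (edgePerm (Equiv.swap i j)) V) V) s U)) /
          Fintype.card Bool = (dens G r x U + dens G r (x ∘ Equiv.swap i j) U) / 2 := fun U => by
    simp only [Fintype.sum_bool, cond_true, cond_false, dens_swap, Fintype.card_bool, Nat.cast_ofNat]
    ring
  have hmeany : ∀ U : LGConfig 4 G,
      (∑ s : Bool, dens G r (x ∘ Equiv.swap i j)
          ((fun (s : Bool) (V : LGConfig 4 G) => cond s (relabelConfig (edgePerm (Equiv.swap i j)) V) V) s U)) / Fintype.card Bool =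
        (dens G r x U + dens G r (x ∘ Equiv.swap i j) U) / 2 := fun U => by
    simp only [Fintype.sum_bool, cond_true, cond_false, dens_swap, hxx, Fintype.card_bool, Nat.cast_ofNat]
  have h := orbitCovFloor_le_of_e2osc_neg r a ha0 hℓ hE2 c b η
    (fun (s : Bool) (V : LGConfig 4 G) => cond s (relabelConfig (edgePerm (Equiv.swap i j)) V) V)
    (continuous_swapFamily i j) (fun β s F _ => swapFamily_symm r i j hc b hη β s F) hx hy (c₀ := Δ ^ 2 / 4) (ρ := ρ) (t₀ := t₀)
    (fun ζ hζ => by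
      rw [hstat]
      have h1 := (hGS ζ hζ).1
      have h2 : Δ ^ 2 ≤ (dens G r x (glueWith (cubeEdges c b) ζ η) - dens G r (x ∘ Equiv.swap i j) (glueWith (cubeEdges c b) ζ η)) ^ 2 := by
        rw [← sq_abs (dens G r x _ - _)]
        exact pow_le_pow_left₀ hΔ h1 2
      linarith)
    (fun ζ hζ => by rw [hmeanx]; exact (hGS ζ hζ).2) (fun ζ hζ => by rw [hmeany]; exact (hGS ζ hζ).2)
  exact h

end Swap

end Summit.QuantumFields.YangMills.Cruxes.NT.ClassicalShadow

end
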